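import Mathlib
import Literature.Analysis.FluidPDE.PoincareBall

/-!
# Infinite Dirichlet energy of a `(−1)`-homogeneous profile near the origin, on disjoint balls

Helper file for crux `LandauTailBlowup` (stmt-NavierStokesRegularity-1944), line `registered`,
registered stub `landauTail_profile_gradient_dyadic` (B2, "the gradient of a nonzero
`(−1)`-homogeneous profile has infinite Dirichlet energy near `0`, witnessed on disjoint balls").

Let `U ∈ C¹(ℝ³ ∖ 0; ℝ³)` be `(−1)`-homogeneous, `U(c x) = c⁻¹ U(x)` for `c > 0`, and not
identically zero.  Then for every `ρ > 0` and every level `M` there are finitely many pairwise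
disjoint balls `B(x_j, r_j)` with closures in `B_ρ ∖ {0}` and inner radii `δ_j < r_j` such that
`Σ_j ∫_{B(x_j, δ_j)} ‖DU‖² > M`.

Proof (elementary, folklore).  `U 0 = 0` by homogeneity, so a point `x₁` with `U x₁ ≠ 0` is
nonzero; rescale it to `x₀` with `‖x₀‖ = ρ/2`, still `U x₀ ≠ 0`.  The base energy
`I = ∫_{B(x₀, ρ/8)} ‖DU‖²` is nonzero: otherwise `DU = 0` a.e. on the ball, hence everywhere
there (continuity, open sets have positive Lebesgue measure), so `U` is constant on the ball
(mean value), contradicting `U((9/8) x₀) = (8/9) U(x₀) ≠ U(x₀)`.  Differentiating the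
homogeneity identity gives `DU(c x) = c⁻² DU(x)`, so by the substitution `y = c x`
(`Literature.Analysis.FluidPDE.PoincareBall.lintegral_comp_smul_add`, Jacobian `c³`)
`∫_{B(c x₀, c ρ/8)} ‖DU‖² = c⁻¹ I ≥ I` for `0 < c ≤ 1`.  The dyadic balls
`B(2^{-j} x₀, 2^{-j} ρ/6)`, `j < J`, lie in the disjoint shells
`2^{-j} ρ/3 < ‖y‖ < 2^{-j} 2ρ/3` inside `B_ρ ∖ {0}`, and `J` with `J · I > M` exists since
`I ≠ 0` (`ENNReal.exists_nat_mul_gt`).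
-/

set_option linter.dupNamespace false

namespace Summit.NavierStokesRegularity.NavierStokesRegularity.Theorems

open MeasureTheory Set Filter Metric Topology
open scoped ENNReal NNReal Pointwise

/-- A `(−1)`-homogeneous map vanishes at the origin: `U 0 = 2⁻¹ • U 0`. [folklore] -/
theorem landauTail_gradDyadic_profile_zero
    (U : EuclideanSpace ℝ (Fin 3) → EuclideanSpace ℝ (Fin 3))
    (hhom : ∀ c : ℝ, 0 < c → ∀ x : EuclideanSpace ℝ (Fin 3), U (c • x) = c⁻¹ • U x) :
    U 0 = 0 := by
  have h := hhom 2 two_pos 0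
  rw [smul_zero] at h
  have h2 : (1 - (2 : ℝ)⁻¹) • U 0 = 0 := by
    rw [sub_smul, one_smul, ← h, sub_self]
  rcases smul_eq_zero.1 h2 with h3 | h3
  · norm_num at h3
  · exact h3

/-- **Euler scaling of the derivative** [folklore]: if `U ∈ C¹(ℝ³ ∖ 0)` satisfies
`U (c • x) = c⁻¹ • U x` for `c > 0`, then `DU (c • x) = c⁻² DU (x)` for `x ≠ 0` (chain rule on
`U ∘ (c • ·) = c⁻¹ • U` and uniqueness of the Fréchet derivative). -/
theorem landauTail_gradDyadic_fderiv_smul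
    (U : EuclideanSpace ℝ (Fin 3) → EuclideanSpace ℝ (Fin 3)) (hU : ContDiffOn ℝ 1 U {0}ᶜ)
    (hhom : ∀ c : ℝ, 0 < c → ∀ x : EuclideanSpace ℝ (Fin 3), U (c • x) = c⁻¹ • U x)
    {c : ℝ} (hc : 0 < c) {x : EuclideanSpace ℝ (Fin 3)} (hx : x ≠ 0) :
    fderiv ℝ U (c • x) = c⁻¹ • (c⁻¹ • fderiv ℝ U x) := by
  have hdiff : DifferentiableOn ℝ U {0}ᶜ := hU.differentiableOn one_ne_zero
  have hcx : c • x ≠ 0 := smul_ne_zero hc.ne' hx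
  have h1 : HasFDerivAt U (fderiv ℝ U (c • x)) (c • x) :=
    (hdiff.differentiableAt
      (isOpen_compl_singleton.mem_nhds (mem_compl_singleton_iff.2 hcx))).hasFDerivAt
  have h2 : HasFDerivAt (fun y : EuclideanSpace ℝ (Fin 3) => c • y)
      (c • ContinuousLinearMap.id ℝ (EuclideanSpace ℝ (Fin 3))) x :=
    (hasFDerivAt_id x).const_smul c
  have h3 : HasFDerivAt (fun y : EuclideanSpace ℝ (Fin 3) => U (c • y))
      ((fderiv ℝ U (c • x)).comp (c • ContinuousLinearMap.id ℝ (EuclideanSpace ℝ (Fin 3)))) x :=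
    h1.comp x h2
  have h4 : HasFDerivAt (fun y : EuclideanSpace ℝ (Fin 3) => U (c • y)) (c⁻¹ • fderiv ℝ U x) x := by
    have heq : (fun y : EuclideanSpace ℝ (Fin 3) => U (c • y)) = fun y => c⁻¹ • U y :=
      funext (hhom c hc)
    rw [heq]
    exact (hdiff.differentiableAt
      (isOpen_compl_singleton.mem_nhds (mem_compl_singleton_iff.2 hx))).hasFDerivAt.const_smul c⁻¹
  have h5 := h3.unique h4
  rw [ContinuousLinearMap.comp_smul, ContinuousLinearMap.comp_id] at h5
  rw [← h5, inv_smul_smul₀ hc.ne']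

/-- **Dilating a ball in a Lebesgue integral over `ℝ³`** [folklore]:
`∫_{B(c x₀, c d)} G = c³ ∫_{B(x₀, d)} G(c x) dx` for `c > 0` (affine substitution
`Literature.Analysis.FluidPDE.PoincareBall.lintegral_comp_smul_add` on indicator functions). -/
theorem landauTail_gradDyadic_setLIntegral_ball_smul (G : EuclideanSpace ℝ (Fin 3) → ℝ≥0∞)
    {c : ℝ} (hc : 0 < c) (x₀ : EuclideanSpace ℝ (Fin 3)) (d : ℝ) :
    ∫⁻ y in ball (c • x₀) (c * d), G y =
      ENNReal.ofReal (c ^ 3) * ∫⁻ x in ball x₀ d, G (c • x) := by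
  have hc0 : c ≠ 0 := hc.ne'
  have hball : ball (c • x₀) (c * d) = c • ball x₀ d := by
    rw [_root_.smul_ball hc0, Real.norm_of_nonneg hc.le]
  have hind : ∀ x : EuclideanSpace ℝ (Fin 3), (ball x₀ d).indicator (fun z => G (c • z)) x =
      (ball (c • x₀) (c * d)).indicator G (c • x + 0) := by
    intro x
    rw [add_zero, hball]
    by_cases hx : x ∈ ball x₀ d
    · rw [indicator_of_mem hx, indicator_of_mem ((Set.smul_mem_smul_set_iff₀ hc0 _ _).2 hx)]
    · rw [indicator_of_notMem hx,
        indicator_of_notMem (fun h => hx ((Set.smul_mem_smul_set_iff₀ hc0 _ _).1 h))]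
  have hfin : Module.finrank ℝ (EuclideanSpace ℝ (Fin 3)) = 3 := finrank_euclideanSpace_fin
  calc ∫⁻ y in ball (c • x₀) (c * d), G y
      = ∫⁻ y, (ball (c • x₀) (c * d)).indicator G y :=
        (lintegral_indicator measurableSet_ball _).symm
    _ = ENNReal.ofReal (c ^ 3) *
          (ENNReal.ofReal |(c ^ Module.finrank ℝ (EuclideanSpace ℝ (Fin 3)))⁻¹| *
            ∫⁻ y, (ball (c • x₀) (c * d)).indicator G y) := by
        rw [hfin, ← mul_assoc, ← ENNReal.ofReal_mul (by positivity), abs_of_pos (by positivity),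
          mul_inv_cancel₀ (by positivity), ENNReal.ofReal_one, one_mul]
    _ = ENNReal.ofReal (c ^ 3) * ∫⁻ x, (ball (c • x₀) (c * d)).indicator G (c • x + 0) := by
        rw [Literature.Analysis.FluidPDE.PoincareBall.lintegral_comp_smul_add _ hc0]
    _ = ENNReal.ofReal (c ^ 3) * ∫⁻ x, (ball x₀ d).indicator (fun z => G (c • z)) x := by
        congr 1
        exact lintegral_congr fun x => (hind x).symm
    _ = ENNReal.ofReal (c ^ 3) * ∫⁻ x in ball x₀ d, G (c • x) := by
        rw [lintegral_indicator measurableSet_ball]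

/-- **Dyadic monotonicity of the local Dirichlet energy** [folklore]: for a `(−1)`-homogeneous
`C¹` profile, a ball `B(x₀, d)` avoiding the origin and `0 < c ≤ 1`,
`∫_{B(x₀, d)} ‖DU‖² ≤ ∫_{B(c x₀, c d)} ‖DU‖²` (the right side equals `c⁻¹` times the left:
Jacobian `c³` against `‖DU(c x)‖² = c⁻⁴ ‖DU(x)‖²`). -/
theorem landauTail_gradDyadic_le_setLIntegral_smul
    (U : EuclideanSpace ℝ (Fin 3) → EuclideanSpace ℝ (Fin 3)) (hU : ContDiffOn ℝ 1 U {0}ᶜ)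
    (hhom : ∀ c : ℝ, 0 < c → ∀ x : EuclideanSpace ℝ (Fin 3), U (c • x) = c⁻¹ • U x)
    {x₀ : EuclideanSpace ℝ (Fin 3)} {d : ℝ} (hsub : ball x₀ d ⊆ {0}ᶜ) {c : ℝ} (hc : 0 < c)
    (hc1 : c ≤ 1) :
    ∫⁻ y in ball x₀ d, ‖fderiv ℝ U y‖ₑ ^ 2 ≤
      ∫⁻ y in ball (c • x₀) (c * d), ‖fderiv ℝ U y‖ₑ ^ 2 := by
  have hc0 : c ≠ 0 := hc.ne'
  rw [landauTail_gradDyadic_setLIntegral_ball_smul _ hc]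
  have hpt : ∀ x ∈ ball x₀ d, ‖fderiv ℝ U (c • x)‖ₑ ^ 2 =
      ENNReal.ofReal ((c⁻¹ * c⁻¹) ^ 2) * ‖fderiv ℝ U x‖ₑ ^ 2 := by
    intro x hx
    rw [landauTail_gradDyadic_fderiv_smul U hU hhom hc (mem_compl_singleton_iff.1 (hsub hx)),
      smul_smul, enorm_smul, mul_pow, Real.enorm_eq_ofReal (by positivity),
      ENNReal.ofReal_pow (by positivity)]
  rw [setLIntegral_congr_fun measurableSet_ball hpt, lintegral_const_mul' _ _ ENNReal.ofReal_ne_top,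
    ← mul_assoc, ← ENNReal.ofReal_mul (by positivity)]
  have h1 : (1 : ℝ≥0∞) ≤ ENNReal.ofReal (c ^ 3 * (c⁻¹ * c⁻¹) ^ 2) := by
    rw [ENNReal.one_le_ofReal]
    have : c ^ 3 * (c⁻¹ * c⁻¹) ^ 2 = c⁻¹ := by
      field_simp
    rw [this, one_le_inv₀ hc]
    exact hc1
  calc ∫⁻ y in ball x₀ d, ‖fderiv ℝ U y‖ₑ ^ 2
      = 1 * ∫⁻ y in ball x₀ d, ‖fderiv ℝ U y‖ₑ ^ 2 := (one_mul _).symm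
    _ ≤ ENNReal.ofReal (c ^ 3 * (c⁻¹ * c⁻¹) ^ 2) * ∫⁻ y in ball x₀ d, ‖fderiv ℝ U y‖ₑ ^ 2 := by
        gcongr

/-- **The base energy is nonzero** [folklore]: if `U ∈ C¹(ℝ³ ∖ 0)` is `(−1)`-homogeneous,
`U x₀ ≠ 0`, and the ball `B(x₀, d)` avoids the origin and contains `(9/8) x₀`, then
`∫_{B(x₀, d)} ‖DU‖² ≠ 0`: otherwise `DU = 0` a.e., hence everywhere on the ball by continuity,
so `U` is constant there, contradicting `U((9/8) x₀) = (8/9) U(x₀)`. -/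
theorem landauTail_gradDyadic_setLIntegral_ne_zero
    (U : EuclideanSpace ℝ (Fin 3) → EuclideanSpace ℝ (Fin 3)) (hU : ContDiffOn ℝ 1 U {0}ᶜ)
    (hhom : ∀ c : ℝ, 0 < c → ∀ x : EuclideanSpace ℝ (Fin 3), U (c • x) = c⁻¹ • U x)
    {x₀ : EuclideanSpace ℝ (Fin 3)} (hx₀ : U x₀ ≠ 0) {d : ℝ} (hd : 0 < d)
    (hsub : ball x₀ d ⊆ {0}ᶜ) (hmem : ((9 : ℝ) / 8) • x₀ ∈ ball x₀ d) :
    ∫⁻ y in ball x₀ d, ‖fderiv ℝ U y‖ₑ ^ 2 ≠ 0 := by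
  intro h0
  have hmeas : AEMeasurable (fun y => ‖fderiv ℝ U y‖ₑ ^ 2) (volume.restrict (ball x₀ d)) :=
    ((measurable_fderiv ℝ U).enorm.pow_const 2).aemeasurable
  have hae : (fun y => ‖fderiv ℝ U y‖ₑ ^ 2) =ᵐ[volume.restrict (ball x₀ d)] 0 :=
    (lintegral_eq_zero_iff' hmeas).1 h0
  have hae' : fderiv ℝ U =ᵐ[volume.restrict (ball x₀ d)] 0 := by
    filter_upwards [hae] with y hy
    have hy' : ‖fderiv ℝ U y‖ₑ = 0 := by simpa using hy
    rw [Pi.zero_apply]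
    exact (enorm_eq_zero (a := fderiv ℝ U y)).1 hy'
  have hcont : ContinuousOn (fderiv ℝ U) (ball x₀ d) :=
    (hU.continuousOn_fderiv_of_isOpen isOpen_compl_singleton le_rfl).mono hsub
  have hzero : EqOn (fderiv ℝ U) 0 (ball x₀ d) :=
    Measure.eqOn_open_of_ae_eq hae' isOpen_ball hcont continuous_zero.continuousOn
  have hdiff : DifferentiableOn ℝ U (ball x₀ d) := (hU.differentiableOn one_ne_zero).mono hsub
  have hconst : U x₀ = U (((9 : ℝ) / 8) • x₀) :=
    (convex_ball x₀ d).is_const_of_fderivWithin_eq_zero hdiff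
      (fun x hx => by rw [fderivWithin_of_isOpen isOpen_ball hx]; exact hzero hx)
      (mem_ball_self hd) hmem
  rw [hhom _ (by norm_num) x₀] at hconst
  have h2 : (1 - ((9 : ℝ) / 8)⁻¹) • U x₀ = 0 := by
    rw [sub_smul, one_smul, ← hconst, sub_self]
  rcases smul_eq_zero.1 h2 with h3 | h3
  · norm_num at h3
  · exact hx₀ h3

/-- **B2 — the gradient of a nonzero `(−1)`-homogeneous profile has infinite Dirichlet energy
near the origin, witnessed on disjoint balls** [folklore] (registered stub B2 of crux
`LandauTailBlowup`, stmt-NavierStokesRegularity-1944): for `U ∈ C¹(ℝ³ ∖ 0)` with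
`U(c x) = c⁻¹ U(x)` and `U ≢ 0`, every `ρ > 0` and every level `M`, there are finitely many
pairwise disjoint balls `B(x_j, r_j)`, closures inside `B_ρ ∖ {0}`, and inner radii `δ_j < r_j`
with `Σ_j ∫_{B(x_j,δ_j)} ‖DU‖² > M`.  The balls are dyadic, `x_j = 2^{-j} x₀`,
`r_j = 2^{-j} ρ/6`, `δ_j = 2^{-j} ρ/8` along the ray of a point `x₀`, `‖x₀‖ = ρ/2`, where
`U x₀ ≠ 0`; each carries at least the base energy `∫_{B(x₀, ρ/8)} ‖DU‖² ≠ 0`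
(`landauTail_gradDyadic_le_setLIntegral_smul`, `landauTail_gradDyadic_setLIntegral_ne_zero`). -/
theorem landauTail_profile_gradient_dyadic : ∀ (U : EuclideanSpace ℝ (Fin 3) → EuclideanSpace ℝ (Fin 3)), ContDiffOn ℝ 1 U {0}ᶜ → (∀ c : ℝ, 0 < c → ∀ x : EuclideanSpace ℝ (Fin 3), U (c • x) = c⁻¹ • U x) → (∃ x : EuclideanSpace ℝ (Fin 3), U x ≠ 0) → ∀ ρ : ℝ, 0 < ρ → ∀ M : NNReal, ∃ (J : ℕ) (x : Fin J → EuclideanSpace ℝ (Fin 3)) (δ r : Fin J → ℝ), (∀ j, 0 < δ j ∧ δ j < r j) ∧ (∀ j, Metric.closedBall (x j) (r j) ⊆ Metric.ball (0 : EuclideanSpace ℝ (Fin 3)) ρ \ {0}) ∧ (Pairwise fun i j => Disjoint (Metric.ball (x i) (r i)) (Metric.ball (x j) (r j))) ∧ (M : ENNReal) < ∑ j, ∫⁻ y in Metric.ball (x j) (δ j), ‖fderiv ℝ U y‖ₑ ^ 2 := by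
  intro U hU hhom hne ρ hρ M
  obtain ⟨x₁, hx₁⟩ := hne
  have hx₁0 : x₁ ≠ 0 := by
    rintro rfl
    exact hx₁ (landauTail_gradDyadic_profile_zero U hhom)
  have hnx₁ : 0 < ‖x₁‖ := norm_pos_iff.2 hx₁0
  -- the base point `x₀` on the ray of `x₁`, `‖x₀‖ = ρ / 2`, `U x₀ ≠ 0`
  obtain ⟨x₀, hx₀, hUx₀⟩ : ∃ x₀ : EuclideanSpace ℝ (Fin 3), ‖x₀‖ = ρ / 2 ∧ U x₀ ≠ 0 := by
    refine ⟨(ρ / (2 * ‖x₁‖)) • x₁, ?_, ?_⟩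
    · rw [norm_smul, Real.norm_of_nonneg (by positivity)]
      field_simp
    · rw [hhom _ (by positivity) x₁]
      exact smul_ne_zero (inv_ne_zero (by positivity)) hx₁
  have hsub : ball x₀ (ρ / 8) ⊆ {0}ᶜ := by
    intro y hy
    rw [mem_ball, dist_eq_norm] at hy
    have h1 := norm_sub_norm_le x₀ y
    rw [norm_sub_rev, hx₀] at h1
    have h2 : 0 < ‖y‖ := by linarith
    exact mem_compl_singleton_iff.2 (norm_pos_iff.1 h2)
  have hmem : ((9 : ℝ) / 8) • x₀ ∈ ball x₀ (ρ / 8) := by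
    rw [mem_ball, dist_eq_norm]
    have h1 : ((9 : ℝ) / 8) • x₀ - x₀ = (8 : ℝ)⁻¹ • x₀ := by module
    rw [h1, norm_smul, Real.norm_of_nonneg (by norm_num), hx₀]
    linarith
  -- the base energy and the number of balls
  have hI : ∫⁻ y in ball x₀ (ρ / 8), ‖fderiv ℝ U y‖ₑ ^ 2 ≠ 0 :=
    landauTail_gradDyadic_setLIntegral_ne_zero U hU hhom hUx₀ (by positivity) hsub hmem
  obtain ⟨J, hJ⟩ := ENNReal.exists_nat_mul_gt hI (ENNReal.coe_ne_top : (M : ℝ≥0∞) ≠ ⊤)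
  -- dyadic scales `t j = 2^{-j}`
  obtain ⟨t, ht0, ht1, htlt⟩ : ∃ t : ℕ → ℝ, (∀ j, 0 < t j) ∧ (∀ j, t j ≤ 1) ∧
      (∀ i j, i < j → t j ≤ t i * 2⁻¹) := by
    refine ⟨fun j => (2⁻¹ : ℝ) ^ j, fun j => ?_, fun j => ?_, fun i j h => ?_⟩
    · show (0 : ℝ) < 2⁻¹ ^ j
      positivity
    · show (2⁻¹ : ℝ) ^ j ≤ 1
      exact pow_le_one₀ (by norm_num) (by norm_num)
    · show (2⁻¹ : ℝ) ^ j ≤ 2⁻¹ ^ i * 2⁻¹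
      calc (2⁻¹ : ℝ) ^ j ≤ 2⁻¹ ^ (i + 1) := pow_le_pow_of_le_one (by norm_num) (by norm_num) h
        _ = 2⁻¹ ^ i * 2⁻¹ := pow_succ _ _
  have hnormx : ∀ j, ‖t j • x₀‖ = t j * (ρ / 2) := fun j => by
    rw [norm_smul, Real.norm_of_nonneg (ht0 j).le, hx₀]
  -- balls of different generations lie in disjoint shells
  have key : ∀ i j : ℕ, i < j →
      Disjoint (ball (t i • x₀) (t i * (ρ / 6))) (ball (t j • x₀) (t j * (ρ / 6))) := by
    intro i j hij
    refine Set.disjoint_left.2 fun y hyi hyj => ?_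
    rw [mem_ball, dist_eq_norm] at hyi hyj
    have h1 := norm_sub_norm_le (t i • x₀) y
    rw [norm_sub_rev, hnormx] at h1
    have h2 := norm_sub_norm_le y (t j • x₀)
    rw [hnormx] at h2
    have h3 := mul_le_mul_of_nonneg_right (htlt i j hij) hρ.le
    nlinarith [ht0 i, ht0 j]
  refine ⟨J, fun j => t j • x₀, fun j => t j * (ρ / 8), fun j => t j * (ρ / 6), ?_, ?_, ?_, ?_⟩
  · intro j
    exact ⟨mul_pos (ht0 j) (by positivity), mul_lt_mul_of_pos_left (by linarith) (ht0 j)⟩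
  · intro j y hy
    rw [mem_closedBall, dist_eq_norm] at hy
    have h1 := norm_sub_norm_le y (t j • x₀)
    have h2 := norm_sub_norm_le (t j • x₀) y
    rw [norm_sub_rev] at h2
    rw [hnormx] at h1 h2
    have h3 := mul_le_mul_of_nonneg_right (ht1 j) hρ.le
    have h4 := mul_pos (ht0 j) hρ
    have h5 : ‖y‖ < ρ := by nlinarith
    have h6 : 0 < ‖y‖ := by nlinarith
    exact ⟨mem_ball_zero_iff.2 h5, fun h => norm_pos_iff.1 h6 (mem_singleton_iff.1 h)⟩
  · intro i j hij
    rcases lt_or_gt_of_ne (Fin.val_injective.ne hij) with h | h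
    · exact key i j h
    · exact (key j i h).symm
  · calc (M : ℝ≥0∞) < J * ∫⁻ y in ball x₀ (ρ / 8), ‖fderiv ℝ U y‖ₑ ^ 2 := hJ
      _ = ∑ _j : Fin J, ∫⁻ y in ball x₀ (ρ / 8), ‖fderiv ℝ U y‖ₑ ^ 2 := by
          rw [Finset.sum_const, Finset.card_univ, Fintype.card_fin, nsmul_eq_mul]
      _ ≤ ∑ j : Fin J, ∫⁻ y in ball (t j • x₀) (t j * (ρ / 8)), ‖fderiv ℝ U y‖ₑ ^ 2 :=
          Finset.sum_le_sum fun j _ =>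
            landauTail_gradDyadic_le_setLIntegral_smul U hU hhom hsub (ht0 j) (ht1 j)

end Summit.NavierStokesRegularity.NavierStokesRegularity.Theorems
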